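import Summits.QuantumFields.QCD.Theorems.PauliWegnerSeaFMClosureUnquenchedClosureC1Aux2
import Summits.QuantumFields.QCD.Theorems.PauliWegnerSeaFMClosureUnquenchedClosureC1Aux3

/-!
# Crux `FMClosureUnquenched` (stmt-QuantumFields-11512), line `von-mises-circles`, stub `stub_closure`:
helper 4 — the rate-free exterior bound and the exit moment

Two averaged consequences of the collar resolvent identities under the two-star bounds, at a fixed volume,
coupling, mass vector, probe flavour `f` and exponent `t` (ASFH §2, (2.11)–(2.13) integrated against the
phase-quenched weight):

* `c1_exterior_le` — ONE FORWARD STEP off the odd ball `B = ball(x, r)`: for `z ∉ B`,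
  `E(x,z) ≤ c_T^t · Ξ_r · |sphere(r+1)| · Σ_{p ∈ sphere r} E(x,p)` ((Rfwd) a.e. [(Tinv) for `Bᶜ`],
  subadditivity of `u ↦ u^t`, (Tdec) on the side `Bᶜ`); with the input shell bound this is the rate-free
  bound `ε'` on the whole exterior of the input ball;
* `c1_exit_le` — the EXIT MOMENT of the even box `W = ebox(x, ℓ)`: for `u ∈ W`,
  `pqE[‖G_W(x,u)‖^t] ≤ E(x,u) + c_T^t · Ξ_ℓ · |boxIn ℓ| · Σ_{w' ∈ boxOut ℓ} E(x,w')` ((Rin) a.e. [(Tinv) for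
  `D`], subadditivity, (Tdec) on the side `W`).

Here `E(x,y) = pqE[‖D_f⁻¹(x,y)‖₁^t]` and `Ξ_r = C (1+|β|)^p (1+r)^p`.

References: Aizenman–Schenker–Friedrich–Hundertmark, CMP 224 (2001) 219, §2 [AizenmanEtAl2001].
-/

noncomputable section

open scoped BigOperators
open MeasureTheory Filter
open Literature.MathematicalPhysics.QuantumFieldTheory Literature.MathematicalPhysics.QuantumLattice
  Literature.Probability.LatticeModels Literature.Probability.Moments
open Summit.QuantumFields.QCD.Theorems.VonMisesCircles

namespace Summit.QuantumFields.QCD.Theorems.VonMisesCirclesC1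

/-! ## Integrability of weighted sums -/

section Weights

variable {Nf S : ℕ} (β : ℝ) (mq : Fin Nf → ℝ)

/-- Integrability of `|det 𝔇| · (c Σᵢ Σⱼ gᵢⱼ)` from that of the terms. [folklore] -/
theorem c1_integrable_weight_const_sum₂ {ι κ : Type*} (T : Finset ι) (T' : Finset κ) (c : ℝ)
    (g : ι → κ → GaugeConfig 4 (2 * S + 1) (Matrix.specialUnitaryGroup (Fin 3) ℂ) → ℝ)
    (hg : ∀ i ∈ T, ∀ j ∈ T', Integrable (fun U => ‖(diracMatrix U mq).det‖ * g i j U)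
      (wilsonMeasure (fundamentalRep (Fin 3)) β)) :
    Integrable (fun U : GaugeConfig 4 (2 * S + 1) (Matrix.specialUnitaryGroup (Fin 3) ℂ) =>
      ‖(diracMatrix U mq).det‖ * (c * ∑ i ∈ T, ∑ j ∈ T', g i j U))
      (wilsonMeasure (fundamentalRep (Fin 3)) β) := by
  have h : (fun U : GaugeConfig 4 (2 * S + 1) (Matrix.specialUnitaryGroup (Fin 3) ℂ) =>
      ‖(diracMatrix U mq).det‖ * (c * ∑ i ∈ T, ∑ j ∈ T', g i j U)) =
      fun U => c * ∑ i ∈ T, ∑ j ∈ T', ‖(diracMatrix U mq).det‖ * g i j U := by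
    funext U
    rw [mul_left_comm, Finset.mul_sum]
    simp_rw [Finset.mul_sum]
  rw [h]
  exact (integrable_finsetSum T fun i hi => integrable_finsetSum T' fun j hj => hg i hi j hj).const_mul c

/-- Integrability of `|det 𝔇| · (c Σᵢ Σⱼ Σₖ Σₗ gᵢⱼₖₗ)` from that of the terms. [folklore] -/
theorem c1_integrable_weight_const_sum₄ {ι₁ ι₂ ι₃ ι₄ : Type*} (T₁ : Finset ι₁) (T₂ : Finset ι₂)
    (T₃ : Finset ι₃) (T₄ : Finset ι₄) (c : ℝ)
    (g : ι₁ → ι₂ → ι₃ → ι₄ → GaugeConfig 4 (2 * S + 1) (Matrix.specialUnitaryGroup (Fin 3) ℂ) → ℝ)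
    (hg : ∀ i ∈ T₁, ∀ j ∈ T₂, ∀ k ∈ T₃, ∀ l ∈ T₄,
      Integrable (fun U => ‖(diracMatrix U mq).det‖ * g i j k l U) (wilsonMeasure (fundamentalRep (Fin 3)) β)) :
    Integrable (fun U : GaugeConfig 4 (2 * S + 1) (Matrix.specialUnitaryGroup (Fin 3) ℂ) =>
      ‖(diracMatrix U mq).det‖ * (c * ∑ i ∈ T₁, ∑ j ∈ T₂, ∑ k ∈ T₃, ∑ l ∈ T₄, g i j k l U))
      (wilsonMeasure (fundamentalRep (Fin 3)) β) := by
  have h : (fun U : GaugeConfig 4 (2 * S + 1) (Matrix.specialUnitaryGroup (Fin 3) ℂ) =>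
      ‖(diracMatrix U mq).det‖ * (c * ∑ i ∈ T₁, ∑ j ∈ T₂, ∑ k ∈ T₃, ∑ l ∈ T₄, g i j k l U)) =
      fun U => c * ∑ i ∈ T₁, ∑ j ∈ T₂, ∑ k ∈ T₃, ∑ l ∈ T₄, ‖(diracMatrix U mq).det‖ * g i j k l U := by
    funext U
    rw [mul_left_comm, Finset.mul_sum]
    simp_rw [Finset.mul_sum]
  rw [h]
  exact (integrable_finsetSum T₁ fun i hi => integrable_finsetSum T₂ fun j hj =>
    integrable_finsetSum T₃ fun k hk => integrable_finsetSum T₄ fun l hl => hg i hi j hj k hk l hl).const_mul c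

/-- `pqE` of `c Σᵢ Σⱼ gᵢⱼ`. [folklore] -/
theorem c1_pqE_const_sum₂ {ι κ : Type*} (T : Finset ι) (T' : Finset κ) (c : ℝ)
    (g : ι → κ → GaugeConfig 4 (2 * S + 1) (Matrix.specialUnitaryGroup (Fin 3) ℂ) → ℝ)
    (hg : ∀ i ∈ T, ∀ j ∈ T', Integrable (fun U => ‖(diracMatrix U mq).det‖ * g i j U)
      (wilsonMeasure (fundamentalRep (Fin 3)) β)) :
    pqE Nf S β mq (fun U => c * ∑ i ∈ T, ∑ j ∈ T', g i j U) = c * ∑ i ∈ T, ∑ j ∈ T', pqE Nf S β mq (g i j) := by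
  have hrow : ∀ i ∈ T, Integrable (fun U : GaugeConfig 4 (2 * S + 1) (Matrix.specialUnitaryGroup (Fin 3) ℂ) =>
      ‖(diracMatrix U mq).det‖ * ∑ j ∈ T', g i j U) (wilsonMeasure (fundamentalRep (Fin 3)) β) :=
    fun i hi => (integrable_finsetSum T' fun j hj => hg i hi j hj).congr
      (Eventually.of_forall fun U => (Finset.mul_sum _ _ _).symm)
  rw [c1_pqE_const_mul, c1_pqE_finset_sum β mq T (fun i U => ∑ j ∈ T', g i j U) hrow]
  congr 1
  exact Finset.sum_congr rfl fun i hi => c1_pqE_finset_sum β mq T' (g i) (hg i hi)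

/-- `pqE` of `c Σᵢ Σⱼ Σₖ Σₗ gᵢⱼₖₗ`. [folklore] -/
theorem c1_pqE_const_sum₄ {ι₁ ι₂ ι₃ ι₄ : Type*} (T₁ : Finset ι₁) (T₂ : Finset ι₂) (T₃ : Finset ι₃)
    (T₄ : Finset ι₄) (c : ℝ)
    (g : ι₁ → ι₂ → ι₃ → ι₄ → GaugeConfig 4 (2 * S + 1) (Matrix.specialUnitaryGroup (Fin 3) ℂ) → ℝ)
    (hg : ∀ i ∈ T₁, ∀ j ∈ T₂, ∀ k ∈ T₃, ∀ l ∈ T₄,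
      Integrable (fun U => ‖(diracMatrix U mq).det‖ * g i j k l U) (wilsonMeasure (fundamentalRep (Fin 3)) β)) :
    pqE Nf S β mq (fun U => c * ∑ i ∈ T₁, ∑ j ∈ T₂, ∑ k ∈ T₃, ∑ l ∈ T₄, g i j k l U) =
      c * ∑ i ∈ T₁, ∑ j ∈ T₂, ∑ k ∈ T₃, ∑ l ∈ T₄, pqE Nf S β mq (g i j k l) := by
  have h34 : ∀ i ∈ T₁, ∀ j ∈ T₂, pqE Nf S β mq (fun U => ∑ k ∈ T₃, ∑ l ∈ T₄, g i j k l U) =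
      ∑ k ∈ T₃, ∑ l ∈ T₄, pqE Nf S β mq (g i j k l) := fun i hi j hj => by
    have := c1_pqE_const_sum₂ β mq T₃ T₄ 1 (g i j) (hg i hi j hj)
    simpa only [one_mul] using this
  have hint34 : ∀ i ∈ T₁, ∀ j ∈ T₂,
      Integrable (fun U : GaugeConfig 4 (2 * S + 1) (Matrix.specialUnitaryGroup (Fin 3) ℂ) =>
        ‖(diracMatrix U mq).det‖ * ∑ k ∈ T₃, ∑ l ∈ T₄, g i j k l U) (wilsonMeasure (fundamentalRep (Fin 3)) β) :=
    fun i hi j hj => by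
      have := c1_integrable_weight_const_sum₂ β mq T₃ T₄ 1 (g i j) (hg i hi j hj)
      simpa only [one_mul] using this
  rw [c1_pqE_const_sum₂ β mq T₁ T₂ c (fun i j U => ∑ k ∈ T₃, ∑ l ∈ T₄, g i j k l U) hint34]
  congr 1
  exact Finset.sum_congr rfl fun i hi => Finset.sum_congr rfl fun j hj => h34 i hi j hj

end Weights

/-! ## The two averaged resolvent bounds -/

section Steps

variable {Nf S : ℕ} {β t s₀ C p cT : ℝ} {mq : Fin Nf → ℝ} {f : Fin Nf}

variable (ht0 : 0 < t) (ht1 : t ≤ 1) (hts : t ≤ s₀) (hcT : 0 < cT)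
  (hT0 : ∀ (s₁ s₂ s₃ : ℝ), 0 ≤ s₁ → s₁ ≤ s₀ → 0 ≤ s₂ → s₂ ≤ s₀ → 0 ≤ s₃ → s₃ ≤ s₀ →
      ∀ (A₁ A₂ A₃ : Finset (TorusSite 4 (2 * S + 1))),
        AdmissibleSide S A₁ → AdmissibleSide S A₂ → AdmissibleSide S A₃ →
      ∀ (a₁ b₁ a₂ b₂ a₃ b₃ : TorusSite 4 (2 * S + 1)),
      Integrable (fun U : GaugeConfig 4 (2 * S + 1) (Matrix.specialUnitaryGroup (Fin 3) ℂ) =>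
        ‖(diracMatrix U mq).det‖ *
          (blockNorm (gside A₁ (wilsonD U (mq f))) a₁ b₁ ^ s₁ *
            blockNorm (gside A₂ (wilsonD U (mq f))) a₂ b₂ ^ s₂ *
            blockNorm (gside A₃ (wilsonD U (mq f))) a₃ b₃ ^ s₃))
        (wilsonMeasure (fundamentalRep (Fin 3)) β))
  (hTinv : ∀ (A : Finset (TorusSite 4 (2 * S + 1))), AdmissibleSide S A →
      ∀ᵐ U ∂(wilsonMeasure (d := 4) (L := 2 * S + 1) (fundamentalRep (Fin 3)) β),
        (sideMatrix A (wilsonD U (mq f))).det ≠ 0)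
  (hTdec : ∀ (x : TorusSite 4 (2 * S + 1)) (r : ℕ), 1 ≤ r → r + 1 ≤ S →
      ∀ (A : Finset (TorusSite 4 (2 * S + 1))),
        (A = ebox S x r ∨ A = (ebox S x r)ᶜ ∨ A = (ball S x r)ᶜ) →
      ∀ a b c d : TorusSite 4 (2 * S + 1), a ∈ A → b ∈ A →
        pqE Nf S β mq (fun U =>
            blockNorm (gside A (wilsonD U (mq f))) a b ^ t * blockNorm (wilsonD U (mq f))⁻¹ c d ^ t) ≤
          C * (1 + |β|) ^ p * (1 + (r : ℝ)) ^ p *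
            pqE Nf S β mq (fun U => blockNorm (wilsonD U (mq f))⁻¹ c d ^ t))
  (hR : ∀ (U : GaugeConfig 4 (2 * S + 1) (Matrix.specialUnitaryGroup (Fin 3) ℂ))
      (x : TorusSite 4 (2 * S + 1)),
      (∀ r : ℕ, 1 ≤ r → r + 1 ≤ S → ∀ z : TorusSite 4 (2 * S + 1), z ∉ ball S x r →
        (sideMatrix (ball S x r)ᶜ (wilsonD U (mq f))).det ≠ 0 →
          blockNorm (wilsonD U (mq f))⁻¹ x z ≤
            cT * ∑ p ∈ sphere S x r, ∑ p' ∈ sphere S x (r + 1),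
              blockNorm (wilsonD U (mq f))⁻¹ x p * blockNorm (gside (ball S x r)ᶜ (wilsonD U (mq f))) p' z) ∧
      ∀ ℓ : ℕ, 1 ≤ ℓ → ℓ + 2 ≤ S →
        (∀ u : TorusSite 4 (2 * S + 1), u ∈ ebox S x ℓ → (wilsonD U (mq f)).det ≠ 0 →
          blockNorm (gside (ebox S x ℓ) (wilsonD U (mq f))) x u ≤
            blockNorm (wilsonD U (mq f))⁻¹ x u +
              cT * ∑ w' ∈ boxOut S x ℓ, ∑ w ∈ boxIn S x ℓ,
                blockNorm (wilsonD U (mq f))⁻¹ x w' * blockNorm (gside (ebox S x ℓ) (wilsonD U (mq f))) w u) ∧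
        (3 * ℓ + 4 ≤ S →
          (∀ v' y : TorusSite 4 (2 * S + 1), v' ∉ ebox S x (3 * ℓ + 2) → y ∉ ebox S x (3 * ℓ + 2) →
            (wilsonD U (mq f)).det ≠ 0 →
              blockNorm (gside (ebox S x (3 * ℓ + 2))ᶜ (wilsonD U (mq f))) v' y ≤
                blockNorm (wilsonD U (mq f))⁻¹ v' y +
                  cT * ∑ w' ∈ boxOut S x (3 * ℓ + 2), ∑ w ∈ boxIn S x (3 * ℓ + 2),
                    blockNorm (gside (ebox S x (3 * ℓ + 2))ᶜ (wilsonD U (mq f))) v' w' *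
                      blockNorm (wilsonD U (mq f))⁻¹ w y) ∧
          (∀ y : TorusSite 4 (2 * S + 1), y ∉ ebox S x (3 * ℓ + 2) →
            (sideMatrix (ebox S x ℓ) (wilsonD U (mq f))).det ≠ 0 →
            (sideMatrix (ebox S x (3 * ℓ + 2))ᶜ (wilsonD U (mq f))).det ≠ 0 →
              blockNorm (wilsonD U (mq f))⁻¹ x y ≤
                cT ^ 2 * ∑ u ∈ boxIn S x ℓ, ∑ u' ∈ boxOut S x ℓ,
                  ∑ v ∈ boxIn S x (3 * ℓ + 2), ∑ v' ∈ boxOut S x (3 * ℓ + 2),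
                    blockNorm (gside (ebox S x ℓ) (wilsonD U (mq f))) x u * blockNorm (wilsonD U (mq f))⁻¹ u' v *
                      blockNorm (gside (ebox S x (3 * ℓ + 2))ᶜ (wilsonD U (mq f))) v' y)))

include ht0 ht1 hts hcT hT0 hTinv hTdec hR

/-- **One forward step off the odd ball** ((Rfwd) a.e. + subadditivity + (Tdec) on `(ball r)ᶜ`): for `z`
outside `ball(x, r)` (`1 ≤ r`, `r + 1 ≤ S`),
`E(x,z) ≤ c_T^t Ξ_r |sphere(r+1)| Σ_{p ∈ sphere r} E(x,p)`. [cite: AizenmanEtAl2001, §2 (2.11)] -/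
theorem c1_exterior_le (x : TorusSite 4 (2 * S + 1)) {r : ℕ} (hr1 : 1 ≤ r) (hrS : r + 1 ≤ S)
    (z : TorusSite 4 (2 * S + 1)) (hz : z ∉ ball S x r) :
    pqE Nf S β mq (fun U => blockNorm (wilsonD U (mq f))⁻¹ x z ^ t) ≤
      cT ^ t * (C * (1 + |β|) ^ p * (1 + (r : ℝ)) ^ p) * (sphere S x (r + 1)).card *
        ∑ q ∈ sphere S x r, pqE Nf S β mq (fun U => blockNorm (wilsonD U (mq f))⁻¹ x q ^ t) := by
  have hadm : AdmissibleSide S (ball S x r)ᶜ := Or.inr ⟨x, r, hr1, hrS, Or.inr (Or.inr rfl)⟩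
  -- the a.e. pointwise bound
  have hae : ∀ᵐ U ∂(wilsonMeasure (d := 4) (L := 2 * S + 1) (fundamentalRep (Fin 3)) β),
      blockNorm (wilsonD U (mq f))⁻¹ x z ^ t ≤
        cT ^ t * ∑ q ∈ sphere S x r, ∑ q' ∈ sphere S x (r + 1),
          blockNorm (gside (ball S x r)ᶜ (wilsonD U (mq f))) q' z ^ t * blockNorm (wilsonD U (mq f))⁻¹ x q ^ t := by
    filter_upwards [hTinv _ hadm] with U hU
    have h1 := (hR U x).1 r hr1 hrS z hz hU
    calc blockNorm (wilsonD U (mq f))⁻¹ x z ^ t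
        ≤ (cT * ∑ q ∈ sphere S x r, ∑ q' ∈ sphere S x (r + 1),
            blockNorm (wilsonD U (mq f))⁻¹ x q * blockNorm (gside (ball S x r)ᶜ (wilsonD U (mq f))) q' z) ^ t :=
          Real.rpow_le_rpow (blockNorm_nonneg _ _ _) h1 ht0.le
      _ ≤ cT ^ t * ∑ q ∈ sphere S x r, (∑ q' ∈ sphere S x (r + 1),
            blockNorm (wilsonD U (mq f))⁻¹ x q * blockNorm (gside (ball S x r)ᶜ (wilsonD U (mq f))) q' z) ^ t :=
          c1_rpow_const_mul_sum_le _ hcT.le _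
            (fun q _ => Finset.sum_nonneg fun q' _ => mul_nonneg (blockNorm_nonneg _ _ _) (blockNorm_nonneg _ _ _))
            ht0 ht1
      _ ≤ cT ^ t * ∑ q ∈ sphere S x r, ∑ q' ∈ sphere S x (r + 1),
            (blockNorm (wilsonD U (mq f))⁻¹ x q * blockNorm (gside (ball S x r)ᶜ (wilsonD U (mq f))) q' z) ^ t := by
          refine mul_le_mul_of_nonneg_left (Finset.sum_le_sum fun q _ => ?_) (Real.rpow_nonneg hcT.le _)
          exact rpow_sum_le_sum_rpow _ _
            (fun q' _ => mul_nonneg (blockNorm_nonneg _ _ _) (blockNorm_nonneg _ _ _)) ht0 ht1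
      _ = _ := by
          congr 1
          refine Finset.sum_congr rfl fun q _ => Finset.sum_congr rfl fun q' _ => ?_
          rw [Real.mul_rpow (blockNorm_nonneg _ _ _) (blockNorm_nonneg _ _ _), mul_comm]
  -- integrate
  have hint : ∀ q ∈ sphere S x r, ∀ q' ∈ sphere S x (r + 1),
      Integrable (fun U : GaugeConfig 4 (2 * S + 1) (Matrix.specialUnitaryGroup (Fin 3) ℂ) =>
        ‖(diracMatrix U mq).det‖ *
          (blockNorm (gside (ball S x r)ᶜ (wilsonD U (mq f))) q' z ^ t * blockNorm (wilsonD U (mq f))⁻¹ x q ^ t))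
        (wilsonMeasure (fundamentalRep (Fin 3)) β) :=
    fun q _ q' _ => c1_integrable_two hT0 ht0.le hts hadm q' z x q
  calc pqE Nf S β mq (fun U => blockNorm (wilsonD U (mq f))⁻¹ x z ^ t)
      ≤ pqE Nf S β mq (fun U => cT ^ t * ∑ q ∈ sphere S x r, ∑ q' ∈ sphere S x (r + 1),
          blockNorm (gside (ball S x r)ᶜ (wilsonD U (mq f))) q' z ^ t * blockNorm (wilsonD U (mq f))⁻¹ x q ^ t) :=
        c1_pqE_mono_ae β mq _ _ (fun U => Real.rpow_nonneg (blockNorm_nonneg _ _ _) _)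
          (c1_integrable_weight_const_sum₂ β mq _ _ _ _ hint) hae
    _ = cT ^ t * ∑ q ∈ sphere S x r, ∑ q' ∈ sphere S x (r + 1), pqE Nf S β mq (fun U =>
          blockNorm (gside (ball S x r)ᶜ (wilsonD U (mq f))) q' z ^ t * blockNorm (wilsonD U (mq f))⁻¹ x q ^ t) :=
        c1_pqE_const_sum₂ β mq _ _ _ _ hint
    _ ≤ cT ^ t * ∑ q ∈ sphere S x r, ∑ q' ∈ sphere S x (r + 1),
          C * (1 + |β|) ^ p * (1 + (r : ℝ)) ^ p * pqE Nf S β mq (fun U => blockNorm (wilsonD U (mq f))⁻¹ x q ^ t) := by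
        refine mul_le_mul_of_nonneg_left (Finset.sum_le_sum fun q _ => Finset.sum_le_sum fun q' hq' => ?_)
          (Real.rpow_nonneg hcT.le _)
        exact hTdec x r hr1 hrS _ (Or.inr (Or.inr rfl)) q' z x q
          (Finset.mem_compl.2 (c1_not_mem_ball_of_mem_sphere_succ hrS hq')) (Finset.mem_compl.2 hz)
    _ = _ := by
        simp only [Finset.sum_const, nsmul_eq_mul, Finset.mul_sum]
        refine Finset.sum_congr rfl fun q _ => ?_
        ring

/-- **The exit moment of the even box** ((Rin) a.e. + subadditivity + (Tdec) on `W = ebox(x, ℓ)`): for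
`u ∈ W` (`1 ≤ ℓ`, `ℓ + 2 ≤ S`),
`pqE[‖G_W(x,u)‖^t] ≤ E(x,u) + c_T^t Ξ_ℓ |boxIn ℓ| Σ_{w' ∈ boxOut ℓ} E(x,w')`. [cite: AizenmanEtAl2001, §2 (2.13)] -/
theorem c1_exit_le (x : TorusSite 4 (2 * S + 1)) {ℓ : ℕ} (hℓ1 : 1 ≤ ℓ) (hℓS : ℓ + 2 ≤ S)
    (u : TorusSite 4 (2 * S + 1)) (hu : u ∈ ebox S x ℓ) :
    pqE Nf S β mq (fun U => blockNorm (gside (ebox S x ℓ) (wilsonD U (mq f))) x u ^ t) ≤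
      pqE Nf S β mq (fun U => blockNorm (wilsonD U (mq f))⁻¹ x u ^ t) +
        cT ^ t * (C * (1 + |β|) ^ p * (1 + (ℓ : ℝ)) ^ p) * (boxIn S x ℓ).card *
          ∑ w' ∈ boxOut S x ℓ, pqE Nf S β mq (fun U => blockNorm (wilsonD U (mq f))⁻¹ x w' ^ t) := by
  have hℓS' : ℓ + 1 ≤ S := by omega
  have hadm : AdmissibleSide S (ebox S x ℓ) := Or.inr ⟨x, ℓ, hℓ1, hℓS', Or.inl rfl⟩
  -- the a.e. pointwise bound
  have hae : ∀ᵐ U ∂(wilsonMeasure (d := 4) (L := 2 * S + 1) (fundamentalRep (Fin 3)) β),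
      blockNorm (gside (ebox S x ℓ) (wilsonD U (mq f))) x u ^ t ≤
        blockNorm (wilsonD U (mq f))⁻¹ x u ^ t +
          cT ^ t * ∑ w' ∈ boxOut S x ℓ, ∑ w ∈ boxIn S x ℓ,
            blockNorm (gside (ebox S x ℓ) (wilsonD U (mq f))) w u ^ t * blockNorm (wilsonD U (mq f))⁻¹ x w' ^ t := by
    filter_upwards [c1_ae_det_wilsonD_ne_zero hTinv] with U hU
    have h1 := ((hR U x).2 ℓ hℓ1 hℓS).1 u hu hU
    have hS0 : 0 ≤ cT * ∑ w' ∈ boxOut S x ℓ, ∑ w ∈ boxIn S x ℓ,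
        blockNorm (wilsonD U (mq f))⁻¹ x w' * blockNorm (gside (ebox S x ℓ) (wilsonD U (mq f))) w u :=
      mul_nonneg hcT.le (Finset.sum_nonneg fun _ _ => Finset.sum_nonneg fun _ _ =>
        mul_nonneg (blockNorm_nonneg _ _ _) (blockNorm_nonneg _ _ _))
    calc blockNorm (gside (ebox S x ℓ) (wilsonD U (mq f))) x u ^ t
        ≤ (blockNorm (wilsonD U (mq f))⁻¹ x u + cT * ∑ w' ∈ boxOut S x ℓ, ∑ w ∈ boxIn S x ℓ,
            blockNorm (wilsonD U (mq f))⁻¹ x w' * blockNorm (gside (ebox S x ℓ) (wilsonD U (mq f))) w u) ^ t :=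
          Real.rpow_le_rpow (blockNorm_nonneg _ _ _) h1 ht0.le
      _ ≤ blockNorm (wilsonD U (mq f))⁻¹ x u ^ t + (cT * ∑ w' ∈ boxOut S x ℓ, ∑ w ∈ boxIn S x ℓ,
            blockNorm (wilsonD U (mq f))⁻¹ x w' * blockNorm (gside (ebox S x ℓ) (wilsonD U (mq f))) w u) ^ t :=
          Real.rpow_add_le_add_rpow (blockNorm_nonneg _ _ _) hS0 ht0.le ht1
      _ ≤ blockNorm (wilsonD U (mq f))⁻¹ x u ^ t + cT ^ t * ∑ w' ∈ boxOut S x ℓ, ∑ w ∈ boxIn S x ℓ,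
            (blockNorm (wilsonD U (mq f))⁻¹ x w' * blockNorm (gside (ebox S x ℓ) (wilsonD U (mq f))) w u) ^ t := by
          refine add_le_add le_rfl ((c1_rpow_const_mul_sum_le _ hcT.le _ (fun w' _ => Finset.sum_nonneg
            fun w _ => mul_nonneg (blockNorm_nonneg _ _ _) (blockNorm_nonneg _ _ _)) ht0 ht1).trans ?_)
          refine mul_le_mul_of_nonneg_left (Finset.sum_le_sum fun w' _ => ?_) (Real.rpow_nonneg hcT.le _)
          exact rpow_sum_le_sum_rpow _ _
            (fun w _ => mul_nonneg (blockNorm_nonneg _ _ _) (blockNorm_nonneg _ _ _)) ht0 ht1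
      _ = _ := by
          congr 2
          refine Finset.sum_congr rfl fun w' _ => Finset.sum_congr rfl fun w _ => ?_
          rw [Real.mul_rpow (blockNorm_nonneg _ _ _) (blockNorm_nonneg _ _ _), mul_comm]
  -- integrate
  have hint : ∀ w' ∈ boxOut S x ℓ, ∀ w ∈ boxIn S x ℓ,
      Integrable (fun U : GaugeConfig 4 (2 * S + 1) (Matrix.specialUnitaryGroup (Fin 3) ℂ) =>
        ‖(diracMatrix U mq).det‖ *
          (blockNorm (gside (ebox S x ℓ) (wilsonD U (mq f))) w u ^ t * blockNorm (wilsonD U (mq f))⁻¹ x w' ^ t))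
        (wilsonMeasure (fundamentalRep (Fin 3)) β) :=
    fun w' _ w _ => c1_integrable_two hT0 ht0.le hts hadm w u x w'
  have hintu := c1_integrable_inv hT0 ht0.le hts x u
  calc pqE Nf S β mq (fun U => blockNorm (gside (ebox S x ℓ) (wilsonD U (mq f))) x u ^ t)
      ≤ pqE Nf S β mq (fun U => blockNorm (wilsonD U (mq f))⁻¹ x u ^ t +
          cT ^ t * ∑ w' ∈ boxOut S x ℓ, ∑ w ∈ boxIn S x ℓ,
            blockNorm (gside (ebox S x ℓ) (wilsonD U (mq f))) w u ^ t * blockNorm (wilsonD U (mq f))⁻¹ x w' ^ t) := by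
        refine c1_pqE_mono_ae β mq _ _ (fun U => Real.rpow_nonneg (blockNorm_nonneg _ _ _) _) ?_ hae
        have h2 := c1_integrable_weight_const_sum₂ β mq _ _ (cT ^ t) _ hint
        have := hintu.add h2
        refine this.congr (Eventually.of_forall fun U => ?_)
        simp only [Pi.add_apply, mul_add]
    _ = pqE Nf S β mq (fun U => blockNorm (wilsonD U (mq f))⁻¹ x u ^ t) +
          cT ^ t * ∑ w' ∈ boxOut S x ℓ, ∑ w ∈ boxIn S x ℓ, pqE Nf S β mq (fun U =>
            blockNorm (gside (ebox S x ℓ) (wilsonD U (mq f))) w u ^ t * blockNorm (wilsonD U (mq f))⁻¹ x w' ^ t) := by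
        rw [c1_pqE_add β mq _ _ hintu (c1_integrable_weight_const_sum₂ β mq _ _ (cT ^ t) _ hint),
          c1_pqE_const_sum₂ β mq _ _ _ _ hint]
    _ ≤ pqE Nf S β mq (fun U => blockNorm (wilsonD U (mq f))⁻¹ x u ^ t) +
          cT ^ t * ∑ w' ∈ boxOut S x ℓ, ∑ w ∈ boxIn S x ℓ,
            C * (1 + |β|) ^ p * (1 + (ℓ : ℝ)) ^ p *
              pqE Nf S β mq (fun U => blockNorm (wilsonD U (mq f))⁻¹ x w' ^ t) := by
        refine add_le_add le_rfl (mul_le_mul_of_nonneg_left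
          (Finset.sum_le_sum fun w' _ => Finset.sum_le_sum fun w hw => ?_) (Real.rpow_nonneg hcT.le _))
        exact hTdec x ℓ hℓ1 hℓS' _ (Or.inl rfl) w u x w' (c1_boxIn_subset_ebox x ℓ hw) hu
    _ = _ := by
        congr 1
        simp only [Finset.sum_const, nsmul_eq_mul, Finset.mul_sum]
        refine Finset.sum_congr rfl fun w' _ => ?_
        ring

end Steps

/-- **Registered helper `c1_closure_aux4` of crux stmt-QuantumFields-11512** (line `von-mises-circles`, stub
`stub_closure`): the averaged forward step off the odd ball, hypotheses spelled out. [cite: AizenmanEtAl2001, §2 (2.11)] -/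
theorem c1_closure_aux4 : ∀ (Nf S : ℕ) (β t s₀ C p cT : ℝ) (mq : Fin Nf → ℝ) (f : Fin Nf), 0 < t → t ≤ 1 → t ≤ s₀ → 0 < cT → (∀ (s₁ s₂ s₃ : ℝ), 0 ≤ s₁ → s₁ ≤ s₀ → 0 ≤ s₂ → s₂ ≤ s₀ → 0 ≤ s₃ → s₃ ≤ s₀ → ∀ (A₁ A₂ A₃ : Finset (TorusSite 4 (2 * S + 1))), AdmissibleSide S A₁ → AdmissibleSide S A₂ → AdmissibleSide S A₃ → ∀ (a₁ b₁ a₂ b₂ a₃ b₃ : TorusSite 4 (2 * S + 1)), Integrable (fun U : GaugeConfig 4 (2 * S + 1) (Matrix.specialUnitaryGroup (Fin 3) ℂ) => ‖(diracMatrix U mq).det‖ * (blockNorm (gside A₁ (wilsonD U (mq f))) a₁ b₁ ^ s₁ * blockNorm (gside A₂ (wilsonD U (mq f))) a₂ b₂ ^ s₂ * blockNorm (gside A₃ (wilsonD U (mq f))) a₃ b₃ ^ s₃)) (wilsonMeasure (fundamentalRep (Fin 3)) β)) → (∀ (A : Finset (TorusSite 4 (2 * S + 1))), AdmissibleSide S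 A → ∀ᵐ U ∂(wilsonMeasure (d := 4) (L := 2 * S + 1) (fundamentalRep (Fin 3)) β), (sideMatrix A (wilsonD U (mq f))).det ≠ 0) → (∀ (x : TorusSite 4 (2 * S + 1)) (r : ℕ), 1 ≤ r → r + 1 ≤ S → ∀ (A : Finset (TorusSite 4 (2 * S + 1))), (A = ebox S x r ∨ A = (ebox S x r)ᶜ ∨ A = (ball S x r)ᶜ) → ∀ a b c d : TorusSite 4 (2 * S + 1), a ∈ A → b ∈ A → pqE Nf S β mq (fun U => blockNorm (gside A (wilsonD U (mq f))) a b ^ t * blockNorm (wilsonD U (mq f))⁻¹ c d ^ t) ≤ C * (1 + |β|) ^ p * (1 + (r : ℝ)) ^ p * pqE Nf S β mq (fun U => blockNorm (wilsonD U (mq f))⁻¹ c d ^ t)) → (∀ (U : GaugeConfig 4 (2 * S + 1) (Matrix.specialUnitaryGroup (Fin 3) ℂ)) (x : TorusSite 4 (2 * S + 1)), (∀ r : ℕ, 1 ≤ r → r + 1 ≤ S → ∀ z : TorusSite 4 (2 * S + 1), z ∉ ball S x r → (sideMatrix (ball S x r)ᶜ (wilsonD U (mq f))).det ≠ 0 →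 blockNorm (wilsonD U (mq f))⁻¹ x z ≤ cT * ∑ p ∈ sphere S x r, ∑ p' ∈ sphere S x (r + 1), blockNorm (wilsonD U (mq f))⁻¹ x p * blockNorm (gside (ball S x r)ᶜ (wilsonD U (mq f))) p' z) ∧ ∀ ℓ : ℕ, 1 ≤ ℓ → ℓ + 2 ≤ S → (∀ u : TorusSite 4 (2 * S + 1), u ∈ ebox S x ℓ → (wilsonD U (mq f)).det ≠ 0 → blockNorm (gside (ebox S x ℓ) (wilsonD U (mq f))) x u ≤ blockNorm (wilsonD U (mq f))⁻¹ x u + cT * ∑ w' ∈ boxOut S x ℓ, ∑ w ∈ boxIn S x ℓ, blockNorm (wilsonD U (mq f))⁻¹ x w' * blockNorm (gside (ebox S x ℓ) (wilsonD U (mq f))) w u) ∧ (3 * ℓ + 4 ≤ S → (∀ v' y : TorusSite 4 (2 * S + 1), v' ∉ ebox S x (3 * ℓ + 2) → y ∉ ebox S x (3 * ℓ + 2) → (wilsonD U (mq f)).det ≠ 0 → blockNorm (gside (ebox S x (3 * ℓ + 2))ᶜ (wilsonD U (mq f))) v' y ≤ blockNorm (wilsonD U (mq f))⁻¹ v' y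 + cT * ∑ w' ∈ boxOut S x (3 * ℓ + 2), ∑ w ∈ boxIn S x (3 * ℓ + 2), blockNorm (gside (ebox S x (3 * ℓ + 2))ᶜ (wilsonD U (mq f))) v' w' * blockNorm (wilsonD U (mq f))⁻¹ w y) ∧ (∀ y : TorusSite 4 (2 * S + 1), y ∉ ebox S x (3 * ℓ + 2) → (sideMatrix (ebox S x ℓ) (wilsonD U (mq f))).det ≠ 0 → (sideMatrix (ebox S x (3 * ℓ + 2))ᶜ (wilsonD U (mq f))).det ≠ 0 → blockNorm (wilsonD U (mq f))⁻¹ x y ≤ cT ^ 2 * ∑ u ∈ boxIn S x ℓ, ∑ u' ∈ boxOut S x ℓ, ∑ v ∈ boxIn S x (3 * ℓ + 2), ∑ v' ∈ boxOut S x (3 * ℓ + 2), blockNorm (gside (ebox S x ℓ) (wilsonD U (mq f))) x u * blockNorm (wilsonD U (mq f))⁻¹ u' v * blockNorm (gside (ebox S x (3 * ℓ + 2))ᶜ (wilsonD U (mq f))) v' y))) → ∀ (x : TorusSite 4 (2 * S + 1)) (r : ℕ), 1 ≤ r → r + 1 ≤ S → ∀ (z : TorusSite 4 (2 * S + 1)),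 z ∉ ball S x r → pqE Nf S β mq (fun U => blockNorm (wilsonD U (mq f))⁻¹ x z ^ t) ≤ cT ^ t * (C * (1 + |β|) ^ p * (1 + (r : ℝ)) ^ p) * (sphere S x (r + 1)).card * ∑ q ∈ sphere S x r, pqE Nf S β mq (fun U => blockNorm (wilsonD U (mq f))⁻¹ x q ^ t) :=
  fun _ _ _ _ _ _ _ _ _ _ ht0 ht1 hts hcT hT0 hTinv hTdec hR x _ hr1 hrS z hz =>
    c1_exterior_le ht0 ht1 hts hcT hT0 hTinv hTdec hR x hr1 hrS z hz

end Summit.QuantumFields.QCD.Theorems.VonMisesCirclesC1
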